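import Summits.QuantumFields.GaugeBoot.TwistedSlabHaar
import HarnessLib

/-!
# The Haar average `P = ∫ σ(k) dk` of a unitarised representation is the projection onto its
invariants; the character kernel with the invariants projected out (gauge-boot, Class B;
all-representations form 0/3)

HONEST FRAMING (cell `pub-gaugeboot`, page 1 of every file): the venture produces certified bounds
on lattice expectations at stated coupling, gauge group, dimension and torus size; NOT a mass gap,
NOT a continuum limit, NOT a string tension; NOT Yang–Mills-summit-bearing (barriers
`FixedCouplingUltralocality`, `PerturbativeInvisibility`). Group-theoretic bookkeeping for
`CutLoopProjectedPositivity.lean`; certifies no number.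

## Content

`G` compact, `τ : G → M_M(ℂ)` a continuous representation, `σ = unitarize τ` (tree `UnitaryTrick`),
`P = ∫ σ(k) dk` entrywise (tree `TwistedSlab.haarAvg`, with `P P = P`, `Pᴴ = P` there).

* `unitarize_mul_haarAvg`, `haarAvg_mul_unitarize` — `σ(h) P = P = P σ(h)` (two-sided invariance
  of Haar measure); `unitarize_mulVec_haarAvg_mulVec`, `haarAvg_mulVec_of_forall_mulVec_eq` — the
  range of `P` is exactly the space of `σ`-invariant vectors: `P` IS THE ORTHOGONAL PROJECTION ONTO
  THE INVARIANTS;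
* `trace_haarAvg`, ★ `re_trace_haarAvg` — `m₀(τ) := ∫ Re tr τ(k) dk = Re tr P`, the multiplicity of
  the trivial representation in `τ`;
* ★ `re_trace_mul_inv_sub_eq_sum` — the Gram form of the character kernel with the invariants
  projected out: `Re tr τ(g h⁻¹) - m₀(τ) = ∑_{ab} Re ((Qσ(g))_{ab} conj (Qσ(h))_{ab})`, `Q = 1 - P`
  (the tree's `CompactGroup.re_trace_mul_inv_eq_sum` is the case without `Q`).

Elementary (Bröcker–tom Dieck, Representations of Compact Lie Groups, II.4). [folklore]
-/

open MeasureTheory Complex Finset Function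
open scoped ComplexOrder Matrix

namespace Summit.QuantumFields.GaugeBoot

open Literature.MathematicalPhysics.QuantumFieldTheory (haarProbability)
open Literature.RepresentationTheory.CompactGroups

noncomputable section

/-! ## The Haar average `P = ∫ σ(k) dk` is the projection onto the invariant vectors -/

section HaarAverage

variable {M : ℕ} {G : Type*} [Group G] [TopologicalSpace G] [IsTopologicalGroup G]
  [CompactSpace G] [MeasurableSpace G] [BorelSpace G] (τ : G →* Matrix (Fin M) (Fin M) ℂ)

/-- Entries of the unitarised representation are Haar integrable. -/
theorem integrable_unitarize_entry (hτ : Continuous τ) (a b : Fin M) :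
    Integrable (fun k => CompactGroup.unitarize τ hτ k a b) (haarProbability G) :=
  (CompactGroup.continuous_entry (CompactGroup.continuous_unitarize τ hτ) a b).integrable_of_hasCompactSupport
    (HasCompactSupport.of_compactSpace _)

/-- `σ(h) P = P`: the columns of `P = ∫ σ(k) dk` are `σ`-invariant vectors (left invariance of Haar
measure). -/
theorem unitarize_mul_haarAvg (hτ : Continuous τ) (h : G) :
    CompactGroup.unitarize τ hτ h * TwistedSlab.haarAvg τ hτ = TwistedSlab.haarAvg τ hτ := by
  set σ := CompactGroup.unitarize τ hτ with hσ
  have hint := integrable_unitarize_entry τ hτ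
  ext a b
  simp only [Matrix.mul_apply, TwistedSlab.haarAvg, Matrix.of_apply]
  calc ∑ c, σ h a c * ∫ k, σ k c b ∂(haarProbability G)
      = ∫ k, ∑ c, σ h a c * σ k c b ∂(haarProbability G) := by
        rw [integral_finsetSum _ fun c _ => (hint c b).const_mul _]
        exact Finset.sum_congr rfl fun c _ => (integral_const_mul _ _).symm
    _ = ∫ k, σ (h * k) a b ∂(haarProbability G) := by
        refine integral_congr_ae (ae_of_all _ fun k => ?_)
        simp only [map_mul, Matrix.mul_apply]
    _ = ∫ k, σ k a b ∂(haarProbability G) := integral_mul_left_eq_self (fun k => σ k a b) h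

/-- `P σ(h) = P` (right invariance of Haar measure on a compact group). -/
theorem haarAvg_mul_unitarize (hτ : Continuous τ) (h : G) :
    TwistedSlab.haarAvg τ hτ * CompactGroup.unitarize τ hτ h = TwistedSlab.haarAvg τ hτ := by
  set σ := CompactGroup.unitarize τ hτ with hσ
  have hint := integrable_unitarize_entry τ hτ
  ext a b
  simp only [Matrix.mul_apply, TwistedSlab.haarAvg, Matrix.of_apply]
  calc ∑ c, (∫ k, σ k a c ∂(haarProbability G)) * σ h c b
      = ∫ k, ∑ c, σ k a c * σ h c b ∂(haarProbability G) := by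
        rw [integral_finsetSum _ fun c _ => (hint a c).mul_const _]
        exact Finset.sum_congr rfl fun c _ => (integral_mul_const _ _).symm
    _ = ∫ k, σ (k * h) a b ∂(haarProbability G) := by
        refine integral_congr_ae (ae_of_all _ fun k => ?_)
        simp only [map_mul, Matrix.mul_apply]
    _ = ∫ k, σ k a b ∂(haarProbability G) := integral_mul_right_eq_self (fun k => σ k a b) h

/-- `σ(h) (P v) = P v`: the range of `P` consists of invariant vectors. -/
theorem unitarize_mulVec_haarAvg_mulVec (hτ : Continuous τ) (h : G) (v : Fin M → ℂ) :
    (CompactGroup.unitarize τ hτ h).mulVec ((TwistedSlab.haarAvg τ hτ).mulVec v) =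
      (TwistedSlab.haarAvg τ hτ).mulVec v := by
  rw [Matrix.mulVec_mulVec, unitarize_mul_haarAvg]

/-- `P v = v` for every `σ`-invariant vector `v`: together with `P² = P = Pᴴ`
(`TwistedSlab.haarAvg_mul_haarAvg`, `TwistedSlab.haarAvg_conjTranspose`) and
`unitarize_mulVec_haarAvg_mulVec`, `P` is the orthogonal projection onto the invariants of `σ`. -/
theorem haarAvg_mulVec_of_forall_mulVec_eq (hτ : Continuous τ) {v : Fin M → ℂ}
    (hv : ∀ k, (CompactGroup.unitarize τ hτ k).mulVec v = v) :
    (TwistedSlab.haarAvg τ hτ).mulVec v = v := by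
  set σ := CompactGroup.unitarize τ hτ with hσ
  have hint := integrable_unitarize_entry τ hτ
  funext a
  simp only [Matrix.mulVec, dotProduct, TwistedSlab.haarAvg, Matrix.of_apply]
  calc ∑ b, (∫ k, σ k a b ∂(haarProbability G)) * v b
      = ∫ k, ∑ b, σ k a b * v b ∂(haarProbability G) := by
        rw [integral_finsetSum _ fun b _ => (hint a b).mul_const _]
        exact Finset.sum_congr rfl fun b _ => (integral_mul_const _ _).symm
    _ = ∫ _k, v a ∂(haarProbability G) := by
        refine integral_congr_ae (ae_of_all _ fun k => ?_)
        have h := congrFun (hv k) a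
        simpa only [Matrix.mulVec, dotProduct] using h
    _ = v a := by rw [integral_const, probReal_univ, one_smul]

/-- `tr P = ∫ tr τ(k) dk` (the character of `σ` is that of `τ`). -/
theorem trace_haarAvg (hτ : Continuous τ) :
    (TwistedSlab.haarAvg τ hτ).trace = ∫ k, (τ k).trace ∂(haarProbability G) := by
  have hint := integrable_unitarize_entry τ hτ
  have h1 : ∫ k, (τ k).trace ∂(haarProbability G) =
      ∫ k, ∑ a, CompactGroup.unitarize τ hτ k a a ∂(haarProbability G) :=
    integral_congr_ae (ae_of_all _ fun k => by
      change (τ k).trace = ∑ a, CompactGroup.unitarize τ hτ k a a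
      rw [← CompactGroup.trace_unitarize τ hτ k]
      simp only [Matrix.trace, Matrix.diag_apply])
  rw [h1, integral_finsetSum _ fun a _ => hint a a]
  simp only [Matrix.trace, Matrix.diag_apply, TwistedSlab.haarAvg, Matrix.of_apply]

/-- **`m₀(τ) = Re tr P`**: the Haar mean of the character, `∫ Re tr τ(k) dk`, is the (real) trace of
the invariants projection — the multiplicity of the trivial representation in `τ`. -/
theorem re_trace_haarAvg (hτ : Continuous τ) :
    ((TwistedSlab.haarAvg τ hτ).trace).re = ∫ k, ((τ k).trace).re ∂(haarProbability G) := by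
  have h := integral_re (μ := haarProbability G)
    (hτ.matrix_trace.integrable_of_hasCompactSupport (HasCompactSupport.of_compactSpace _))
  simp only [RCLike.re_to_complex] at h
  rw [trace_haarAvg, h]

omit [TopologicalSpace G] [IsTopologicalGroup G] [CompactSpace G] [MeasurableSpace G] [BorelSpace G] in
/-- `∑_{ab} A_{ab} conj B_{ab} = tr (A Bᴴ)`. -/
theorem sum_mul_conj_eq_trace_mul_conjTranspose (A B : Matrix (Fin M) (Fin M) ℂ) :
    ∑ a, ∑ b, A a b * (starRingEnd ℂ) (B a b) = (A * Bᴴ).trace := by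
  simp only [Matrix.trace, Matrix.diag_apply, Matrix.mul_apply, Matrix.conjTranspose_apply,
    Complex.star_def]

/-- ★ **The Gram form of the character kernel with the invariants projected out**:
`Re tr τ(g h⁻¹) - m₀(τ) = ∑_{ab} Re ((Qσ(g))_{ab} conj (Qσ(h))_{ab})` with `Q = 1 - P`
(`Q` is a Hermitian idempotent commuting past `σ`, `P σ(x) = P`, `tr σ = tr τ`). -/
theorem re_trace_mul_inv_sub_eq_sum (hτ : Continuous τ) (g h : G) :
    ((τ (g * h⁻¹)).trace).re - ((TwistedSlab.haarAvg τ hτ).trace).re =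
      ∑ a, ∑ b, (((1 - TwistedSlab.haarAvg τ hτ) * CompactGroup.unitarize τ hτ g) a b *
        (starRingEnd ℂ) (((1 - TwistedSlab.haarAvg τ hτ) * CompactGroup.unitarize τ hτ h) a b)).re := by
  set σ := CompactGroup.unitarize τ hτ with hσ
  set P := TwistedSlab.haarAvg τ hτ with hP
  set Q : Matrix (Fin M) (Fin M) ℂ := 1 - P with hQ
  have hPP : P * P = P := TwistedSlab.haarAvg_mul_haarAvg τ hτ
  have hPH : Pᴴ = P := TwistedSlab.haarAvg_conjTranspose τ hτ
  have hQH : Qᴴ = Q := by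
    simp only [hQ, Matrix.conjTranspose_sub, Matrix.conjTranspose_one, hPH]
  have hQQ : Q * Q = Q := by
    simp only [hQ, Matrix.sub_mul, Matrix.mul_sub, Matrix.one_mul, Matrix.mul_one, hPP, sub_self,
      sub_zero]
  have hC : (∑ a, ∑ b, (Q * σ g) a b * (starRingEnd ℂ) ((Q * σ h) a b)) =
      (τ (g * h⁻¹)).trace - P.trace := by
    calc (∑ a, ∑ b, (Q * σ g) a b * (starRingEnd ℂ) ((Q * σ h) a b))
        = ((Q * σ g) * (Q * σ h)ᴴ).trace := sum_mul_conj_eq_trace_mul_conjTranspose _ _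
      _ = ((Q * σ g * (σ h)ᴴ) * Qᴴ).trace := by
          simp only [Matrix.conjTranspose_mul, Matrix.mul_assoc]
      _ = (Qᴴ * (Q * σ g * (σ h)ᴴ)).trace := Matrix.trace_mul_comm _ _
      _ = (Q * (σ g * (σ h)ᴴ)).trace := by
          rw [hQH, ← Matrix.mul_assoc, ← Matrix.mul_assoc, hQQ, Matrix.mul_assoc]
      _ = (Q * σ (g * h⁻¹)).trace := by
          rw [map_mul, CompactGroup.unitarize_inv τ hτ h, Matrix.star_eq_conjTranspose]
      _ = (σ (g * h⁻¹)).trace - (P * σ (g * h⁻¹)).trace := by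
          simp only [hQ, Matrix.sub_mul, Matrix.one_mul, Matrix.trace_sub]
      _ = (τ (g * h⁻¹)).trace - P.trace := by
          rw [hP, haarAvg_mul_unitarize τ hτ, hσ, CompactGroup.trace_unitarize τ hτ]
  have hre := congrArg Complex.re hC
  rw [Complex.sub_re] at hre
  rw [← hre, Complex.re_sum]
  exact Finset.sum_congr rfl fun a _ => Complex.re_sum _ _

end HaarAverage

end

end Summit.QuantumFields.GaugeBoot
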